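import Summits.AtomisticToContinuum.FouriersLaw.Theorems.JunctionLocalityNonBallisticDrudeLineDefs
import Summits.AtomisticToContinuum.FouriersLaw.Theorems.BondHeatUncertaintyLinearResponseFTUREquilibriumBondHeatVariance
import Summits.AtomisticToContinuum.FouriersLaw.Theorems.JunctionLocalityNonBallisticStubAutocorrelationContinuous

/-!
# Stub `stub_timeIntegratedCurrentMean` of line `drude-controls-conductance` (R1) — crux `JunctionLocality.NonBallistic`
(stmt-AtomisticToContinuum-9127)

The registered stub `stub_timeIntegratedCurrentMean` (= `DrudeLine.TimeIntegratedCurrentMean`, the lead's split of the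
lever, part 1): under weak-NESS uniqueness (U), along a steady-state family `μ`, for `N ≥ 2`, `T_L, T_R > 0` and
`t ≥ 0`, the time-integrated total current `Φ_t(z, w) = ∫₀ᵗ J_tot(Φ_s(z, B(w))) ds` of the stationary forward process
is integrable on `μ_{N,T_L,T_R} ⊗ W` and `E[Φ_t] = t · totalCurrent(μ_{N,T_L,T_R})`.

Proof (tree facts only; no neighbour stub is used).
* Under (U) the member `ν = μ N T_L T_R` is a probability measure, invariant under the constructed kernels, and
  integrates `e^{ϑH}` for every `0 < ϑ < 1/max(T_L,T_R)` (`BondHeatUncertainty.ness_facts`).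
* `J_tot = totalCurrentObs` is continuous (`pinnedChain_continuous_totalBondCurrent`) and of exponential class
  `|J_tot| ≤ C e^{(ϑ/2)H}` (`pinnedChain_abs_totalBondCurrent_le_exp`), so `J_tot² ≤ C² e^{ϑH} ∈ L¹(ν)` with
  `ϑ = (1/max(T_L,T_R))/2`.
* Mean: the one-time law + Fubini, `LinearResponseFTUR.EquilibriumBondHeatVariance.pinnedChain_integral_intervalIntegral_of_invariant`
  with `f = J_tot`, gives `E[Φ_t] = t ∫ J_tot dν`, and `∫ J_tot dν = totalCurrent ν`
  (`JunctionLocality.totalCurrent_eq_integral_totalCurrentObs`, the bond currents being `ν`-integrable by clause 3 of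
  `IsSteadyState`).
* Integrability: `SubdiffusiveBondHeat.pinnedChain_integrable_intervalIntegral_mul_of_invariant` with `f = J_tot`, `h = 1`
  gives `Φ_t · t ∈ L¹`; for `t > 0` divide the constant out, for `t = 0` `Φ_0 ≡ 0`.
-/

noncomputable section

open MeasureTheory Set Filter Topology
open scoped NNReal ENNReal BigOperators
open Literature.MathematicalPhysics.KineticTheory.HeatConduction

namespace Summit.AtomisticToContinuum.FouriersLaw.Theorems.NonBallistic

open ProbabilityTheory
open Literature.MathematicalPhysics.KineticTheory Literature.Probability.Process OscillatorChain
open Summit.AtomisticToContinuum.FouriersLaw.Theorems.BondHeatUncertainty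
open Summit.AtomisticToContinuum.FouriersLaw.Theorems.SubdiffusiveBondHeat
open Summit.AtomisticToContinuum.FouriersLaw.Theorems.LinearResponseFTUR
open Summit.AtomisticToContinuum.FouriersLaw.Theorems.JunctionLocality
open Summit.AtomisticToContinuum.FouriersLaw.Theorems.NonBallistic.DrudeLine

/-- **The squared total current is integrable in the NESS**: if a law `ν` integrates `e^{ϑH}` for some `ϑ > 0`, then
`J_tot² ∈ L¹(ν)` (`|J_tot| ≤ C e^{(ϑ/2)H}`, `pinnedChain_abs_totalBondCurrent_le_exp`). [folklore] -/
theorem pinnedChain_integrable_sq_totalCurrentObs_of_exp {ω₂ lam β : ℝ} (hω : 0 ≤ ω₂) (hl : 0 ≤ lam) (hβ : 0 ≤ β)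
    (γ : ℝ) (N : ℕ) (ν : Measure (PhaseSpace N)) {ϑ : ℝ} (hϑ : 0 < ϑ)
    (hexp : Integrable (fun x => Real.exp (ϑ * (pinnedChain ω₂ lam β γ).hamiltonian N x)) ν) :
    Integrable (fun y => totalCurrentObs (pinnedChain ω₂ lam β γ) N y ^ 2) ν := by
  obtain ⟨C, hC⟩ : ∃ C : ℝ, ∀ y, |totalCurrentObs (pinnedChain ω₂ lam β γ) N y| ≤
      C * Real.exp (ϑ / 2 * (pinnedChain ω₂ lam β γ).hamiltonian N y) :=
    ⟨_, fun y => pinnedChain_abs_totalBondCurrent_le_exp hω hl hβ γ N (ϑ := ϑ / 2) (by positivity) y⟩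
  have hJc : Continuous (totalCurrentObs (pinnedChain ω₂ lam β γ) N) :=
    pinnedChain_continuous_totalBondCurrent ω₂ lam β γ N
  have hJ2V : ∀ y, totalCurrentObs (pinnedChain ω₂ lam β γ) N y ^ 2 ≤
      C ^ 2 * Real.exp (ϑ * (pinnedChain ω₂ lam β γ).hamiltonian N y) := fun y => by
    have h1 : |totalCurrentObs (pinnedChain ω₂ lam β γ) N y| ^ 2 ≤
        (C * Real.exp (ϑ / 2 * (pinnedChain ω₂ lam β γ).hamiltonian N y)) ^ 2 :=
      pow_le_pow_left₀ (abs_nonneg _) (hC y) 2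
    have h2 : (C * Real.exp (ϑ / 2 * (pinnedChain ω₂ lam β γ).hamiltonian N y)) ^ 2 =
        C ^ 2 * Real.exp (ϑ * (pinnedChain ω₂ lam β γ).hamiltonian N y) := by
      rw [mul_pow, sq (Real.exp _), ← Real.exp_add]
      congr 1
      ring_nf
    rw [sq_abs] at h1
    exact h1.trans_eq h2
  exact (hexp.const_mul (C ^ 2)).mono' (hJc.pow 2).aestronglyMeasurable (Eventually.of_forall fun y => by
    rw [Real.norm_eq_abs, abs_of_nonneg (sq_nonneg _)]; exact hJ2V y)

/-- **Stub `stub_timeIntegratedCurrentMean`** (= `DrudeLine.TimeIntegratedCurrentMean`, the lead's split of the lever,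
part 1): under weak-NESS uniqueness, along a steady-state family, for `N ≥ 2`, `T_L, T_R > 0`, `t ≥ 0`, the
time-integrated total current along the stationary forward process is integrable on `μ_{N,T_L,T_R} ⊗ W` and has mean
`t · totalCurrent(μ_{N,T_L,T_R})` (the member is the kernel-invariant Krylov–Bogoliubov state, `ness_facts`; one-time
law + Fubini, `EquilibriumBondHeatVariance.pinnedChain_integral_intervalIntegral_of_invariant` with `f = J_tot`;
`totalCurrent = ∫ J_tot`, `totalCurrent_eq_integral_totalCurrentObs`; integrability from
`pinnedChain_integrable_intervalIntegral_mul_of_invariant` with `h = 1`). [folklore] -/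
theorem stub_timeIntegratedCurrentMean :
    ∀ ω₂ lam β γ : ℝ, 0 < ω₂ → 0 < lam → 0 < β → 0 < γ →
    (∀ (N : ℕ) (T_L T_R : ℝ), 0 < T_L → 0 < T_R → ∀ μ ν : Measure (PhaseSpace N),
      (pinnedChain ω₂ lam β γ).IsSteadyState N T_L T_R μ →
      (pinnedChain ω₂ lam β γ).IsSteadyState N T_L T_R ν → μ = ν) →
    ∀ μ : (N : ℕ) → ℝ → ℝ → Measure (PhaseSpace N),
      (∀ (N : ℕ) (T_L T_R : ℝ), 0 < T_L → 0 < T_R →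
        (pinnedChain ω₂ lam β γ).IsSteadyState N T_L T_R (μ N T_L T_R)) →
    ∀ N : ℕ, 2 ≤ N → ∀ (T_L T_R : ℝ), 0 < T_L → 0 < T_R → ∀ t : ℝ, 0 ≤ t →
      Integrable (timeIntegratedCurrent (pinnedChain ω₂ lam β γ) N T_L T_R t) ((μ N T_L T_R).prod wienerPair) ∧
      ∫ zw, timeIntegratedCurrent (pinnedChain ω₂ lam β γ) N T_L T_R t zw ∂((μ N T_L T_R).prod wienerPair) =
        t * (pinnedChain ω₂ lam β γ).totalCurrent (μ N T_L T_R) := by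
  intro ω₂ lam β γ hω hl hβ hγ huniq μ hμ N hN T_L T_R hL hR t ht
  -- the member `ν = μ N T_L T_R`: probability, kernel-invariant, exponential moments
  obtain ⟨hprob, hinv, hexp, -⟩ := ness_facts ω₂ lam β γ hω hl hβ hγ huniq μ hμ N hN T_L T_R hL hR
  have hmax : 0 < max T_L T_R := lt_max_of_lt_left hL
  have hϑ0 : 0 < 1 / max T_L T_R / 2 := by positivity
  have hϑ1 : 1 / max T_L T_R / 2 < 1 / max T_L T_R := half_lt_self (by positivity)
  -- the total current: measurable, square integrable, integrates to `totalCurrent`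
  have hJm : Measurable (totalCurrentObs (pinnedChain ω₂ lam β γ) N) :=
    (pinnedChain_continuous_totalBondCurrent ω₂ lam β γ N).measurable
  have hJ2 : Integrable (fun y => totalCurrentObs (pinnedChain ω₂ lam β γ) N y ^ 2) (μ N T_L T_R) :=
    pinnedChain_integrable_sq_totalCurrentObs_of_exp hω.le hl.le hβ.le γ N (μ N T_L T_R) hϑ0 (hexp _ hϑ0 hϑ1)
  have hTC : (pinnedChain ω₂ lam β γ).totalCurrent (μ N T_L T_R) =
      ∫ y, totalCurrentObs (pinnedChain ω₂ lam β γ) N y ∂(μ N T_L T_R) :=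
    totalCurrent_eq_integral_totalCurrentObs _ N _ (hμ N T_L T_R hL hR).2.2
  -- unfold the path functional
  have hdef : timeIntegratedCurrent (pinnedChain ω₂ lam β γ) N T_L T_R t =
      fun zw : PhaseSpace N × WienerPair => ∫ s in (0 : ℝ)..t,
        totalCurrentObs (pinnedChain ω₂ lam β γ) N
          ((pinnedChain ω₂ lam β γ).solMap N T_L T_R s zw.1 (pairPath zw.2)) := rfl
  rw [hdef]
  refine ⟨?_, ?_⟩
  · -- integrability: `Φ_t · t ∈ L¹` (`h = 1`), then divide by `t > 0`; `Φ_0 ≡ 0`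
    rcases ht.eq_or_lt with rfl | ht'
    · simp only [intervalIntegral.integral_same]
      exact integrable_zero _ _ _
    · have hone := pinnedChain_integrable_intervalIntegral_mul_of_invariant hω hl.le hβ.le hγ.le N T_L T_R
        (μ N T_L T_R) hinv (h := fun _ => (1 : ℝ)) hJm measurable_const hJ2 (integrable_const _) ht
      have hΦt : Integrable (fun zw : PhaseSpace N × WienerPair => (∫ s in (0 : ℝ)..t,
          totalCurrentObs (pinnedChain ω₂ lam β γ) N
            ((pinnedChain ω₂ lam β γ).solMap N T_L T_R s zw.1 (pairPath zw.2))) * t)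
          ((μ N T_L T_R).prod wienerPair) := by
        refine hone.congr (Eventually.of_forall fun zw => ?_)
        simp only [intervalIntegral.integral_const, smul_eq_mul, sub_zero, mul_one]
      exact (integrable_mul_const_iff (isUnit_iff_ne_zero.2 ht'.ne') _).1 hΦt
  · -- the mean: one-time law + Fubini
    rw [EquilibriumBondHeatVariance.pinnedChain_integral_intervalIntegral_of_invariant hω hl.le hβ.le hγ.le N T_L T_R
      (μ N T_L T_R) hinv hJm hJ2 ht, hTC]

end Summit.AtomisticToContinuum.FouriersLaw.Theorems.NonBallistic

end
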